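import Mathlib
import HarnessLib
import Summits.HubbardSuperconductivity.HubbardSuperconductivity.Theorems.KLProgrammeKLRegimeEngineScaleZeroTwoLegBareFrameJets
import Summits.HubbardSuperconductivity.HubbardSuperconductivity.Theorems.KLProgrammeKLRegimeEngineV8DefsU9
import Summits.HubbardSuperconductivity.HubbardSuperconductivity.Theorems.KLProgrammeKLRegimeFlowReadResidueOsc

/-!
# Route `KLProgramme`, crux K3 — gen-8 ENGINE-FLOW child (stmt-HubbardSuperconductivity-20437 `KLRegimeEngineV17F2`), stub (C)
# `stub_twoLeg_curvature` at the BASE `n = 0`: «(C)-SCALE0-SPLIT» — the EXACT constant-piece split of the interpolated two-leg symbol,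
# the structured value of `ν₀(0)` from the OFF-SITE two-leg kernel ALONE, and the mean-free clause at scale `0`

Seat hubbard-kl-k3c3-p1 (g11; row «δμ-flow with klAngularMean constant piece»).  The v2 text of stub (C) concludes, at EVERY scale `n`
including `n = 0`, the reading jets `TwoLegReadJetBound … K_n n` AND the mean-free value clause `TwoLegReadOscAt L M (klReadOscC P R) … K_n n`;
the closer's private induction starts from a structured estimate `|ν₀(0)(θ) − τ| ≤ a·U²` at the bare frame `K₀ = 0` (`twoLegReadPriv_zero`,
`value_and_osc_zero_of_structured`; located item #21 «(C)-SCALE0-OSC»).  This file isolates, once and for all, WHAT such an estimate has to bound: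

* §1 **the constant piece of the interpolant is the momentum mean, exactly**: `(symInterp L f)(p) − f_c(0) = Σ_{x ≠ 0} f_c(x)·h_{|x̃₁|,|x̃₂|}(p)` with
  `f_c(0) = L⁻²·Σ_k f(k)` (`eval_symInterp`, `harmonic_zero_zero`), hence `|(symInterp L f)(p) − f_c(0)| ≤ Σ_{x ≠ 0} |f_c(x)|` at every continuum
  momentum — the on-site (`x = 0`) coefficient never enters a mean-free or derivative statement;
* §2 **grid bridge, structured form** (any frame `K`, any scale `n`): if `𝒱⁽ⁿ⁾ − 𝒩_K = map S W` for a grid element `W` whose two-leg kernels have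
  OFF-SITE pinned sums `Σ_{p₁} [x⃗(p₁) ≠ x⃗(p₀)]·‖kernel W 2 ((p₀,σ,+),(p₁,σ,−))‖ ≤ B` (weight `[z ≠ 0]` in p1b's
  `sum_evenWeight_abs_torusCosCoeff_locRe_map_gridSub_le`), then `|I_L[σ_n − K∘p](q) − τ| ≤ (2|P|/(|β|L²))·B` with the θ-free constant
  `τ := (σ_n − K∘p)_c(0)` — every on-site contribution (the first-order Hartree tadpole of the on-site interaction, and whatever else is `k⃗`-blind)
  drops EXACTLY, with no estimate;
* §3 the bare frame `K₀ = 0`, `n = 0` (representation discharged by p1b's `klEffectiveAction_zero_frameZero_eq_map_gridSub`): the structured value of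
  `I_L[σ₀]` from the off-site pinned sum of `kernel₂ (effAction (S_{4M}ᵀ C⁰_{>e₀} S_{4M}) V_{4M})` alone, and its reading on the free Fermi curve
  `|ν₀(0)(θ) − τ₀| ≤ (2|GridPoint L 4M|/(|β|L²))·B`;
* §4 **consumer doors**: an off-site bound in the natural normalisation `B = b·U²·(β/(4M))` gives `|ν₀(0)(θ) − τ₀| ≤ 2b·U²`, the `hAval` input of
  `twoLegReadPriv_zero` (`a := 2b`), and `TwoLegReadOscAt L M (4b) β U μ (K₀) 0`;
* §5 **the tree's generous instance** (p1b's determinant bound `twoLeg_offDiag_moment_pow_sum_frameZero_le` at `k = 0`, `a₀ = klScaleZeroA0` by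
  `rowSum/colSum_scaleZero_le_A0`): `|ν₀(0)(θ) − τ₀| ≤ 2¹⁰·e¹⁸·κ₀⁴·klScaleZeroA0·U²` and `TwoLegReadOscAt L M (2¹¹e¹⁸κ₀⁴·klScaleZeroA0) … (K₀) 0` under
  the smallness `16e⁹κ₀²·klScaleZeroA0·|U| ≤ 1/4` (⇐ `U ≤ klEngU₀9 P R c`).  This constant is ≈ 1.9·10³⁷ (`κ₀² = 2(7+1606732)`, `klScaleZeroA0 ≈ 6.93·10¹²`)
  against the private need `x₀(0) ≲ 0.4` of the first step (memo C1-OSC-IH §2) and the registered `klReadOscC P R = 2⁸¹·klEngPsq²·klEngRsq²`: it records,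
  as a theorem, that the base of (C) needs a NATURAL-SIZE off-site bound (explicit second order at scale `0`) — located item «(C)-SCALE0-NATURAL» of this seat.

Proofs only; no definitions; nothing here asserts any stub of 20437, K3 or superconductivity.
References: BGM 2006 §2.3 (2.17), §3 (3.2)–(3.3) [cite: BenfattoGiulianiMastropietro2006].
-/

noncomputable section

namespace Summit.HubbardSuperconductivity.HubbardSuperconductivity.Theorems.KLRegimeSplit

set_option linter.dupNamespace false -- summit = problem name (single-conjunct summit), D-0017

open Real Finset Literature.MathematicalPhysics.QuantumLattice Literature.Probability.LatticeModels GrassmannAlgebra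
open Literature.MathematicalPhysics.QuantumLattice.FermiRG Literature.Probability.LatticeModels.BattleFederbush
open Summit.HubbardSuperconductivity.HubbardSuperconductivity.Theorems.KLProgrammeLegKernels
open Summit.HubbardSuperconductivity.HubbardSuperconductivity.Theorems.TwoLegFourier
open Summit.HubbardSuperconductivity.HubbardSuperconductivity.Theorems.EngineV8

/-! ## §1 The constant piece of the symmetrised interpolant is the momentum mean — exactly -/

section Interp

variable (L : ℕ) [NeZero L]

/-- **The zero-site cosine coefficient is the momentum-space mean of the data**: `f_c(0) = L⁻²·Σ_k f(k)`. -/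
theorem torusCosCoeff_zero_site (f : TorusSite 2 L → ℝ) :
    torusCosCoeff L f 0 = ((L : ℝ) ^ 2)⁻¹ * ∑ k : TorusSite 2 L, f k := by
  unfold torusCosCoeff
  simp

/-- **Exact constant-piece split of the interpolant**: `(symInterp L f)(p) − f_c(0) = Σ_{x ≠ 0} f_c(x)·h_{|x̃₁|,|x̃₂|}(p)` — the site `x = 0` carries the
harmonic `h_{0,0} = 1`, every other site a bounded harmonic. -/
theorem eval_symInterp_sub_torusCosCoeff_zero (f : TorusSite 2 L → ℝ) (p : Fin 2 → ℝ) :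
    (symInterp L f).eval p - torusCosCoeff L f 0 =
      ∑ x ∈ (univ : Finset (TorusSite 2 L)).filter (fun x => x ≠ 0),
        torusCosCoeff L f x * TrigPolyC4v.harmonic (x 0).valMinAbs.natAbs (x 1).valMinAbs.natAbs p := by
  rw [eval_symInterp, ← Finset.sum_filter_add_sum_filter_not univ (fun x : TorusSite 2 L => x ≠ 0)]
  have hzero : ∑ x ∈ univ.filter (fun x : TorusSite 2 L => ¬x ≠ 0),
      torusCosCoeff L f x * TrigPolyC4v.harmonic (x 0).valMinAbs.natAbs (x 1).valMinAbs.natAbs p = torusCosCoeff L f 0 := by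
    rw [Finset.sum_eq_single_of_mem (0 : TorusSite 2 L) (by simp) fun x hx hx0 => absurd (by simpa using (mem_filter.1 hx).2) hx0]
    simp
  rw [hzero]; ring

/-- **The interpolant is within the OFF-SITE `ℓ¹` mass of its constant piece**: `|(symInterp L f)(p) − f_c(0)| ≤ Σ_{x ≠ 0} |f_c(x)|`. -/
theorem abs_eval_symInterp_sub_torusCosCoeff_zero_le (f : TorusSite 2 L → ℝ) (p : Fin 2 → ℝ) :
    |(symInterp L f).eval p - torusCosCoeff L f 0| ≤
      ∑ x ∈ (univ : Finset (TorusSite 2 L)).filter (fun x => x ≠ 0), |torusCosCoeff L f x| := by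
  rw [eval_symInterp_sub_torusCosCoeff_zero]
  refine (abs_sum_le_sum_abs _ _).trans (sum_le_sum fun x _ => ?_)
  rw [abs_mul]
  exact mul_le_of_le_one_right (abs_nonneg _) (TrigPolyC4v.abs_harmonic_le_one _ _ _)

/-- The same on `Momentum`. -/
theorem abs_evalM_symInterp_sub_torusCosCoeff_zero_le (f : TorusSite 2 L → ℝ) (q : Momentum) :
    |evalM (symInterp L f) q - torusCosCoeff L f 0| ≤
      ∑ x ∈ (univ : Finset (TorusSite 2 L)).filter (fun x => x ≠ 0), |torusCosCoeff L f x| := by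
  rw [evalM_apply]; exact abs_eval_symInterp_sub_torusCosCoeff_zero_le L f _

/-- The off-site `ℓ¹` mass as a weighted sum with the even indicator weight `[x ≠ 0]` (the shape the grid bridge reads). -/
theorem sum_filter_ne_zero_abs_torusCosCoeff_eq (f : TorusSite 2 L → ℝ) :
    ∑ x ∈ (univ : Finset (TorusSite 2 L)).filter (fun x => x ≠ 0), |torusCosCoeff L f x| =
      ∑ x : TorusSite 2 L, (if x = 0 then (0 : ℝ) else 1) * |torusCosCoeff L f x| := by
  rw [sum_filter]
  exact sum_congr rfl fun x _ => by by_cases hx : x = 0 <;> simp [hx]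

end Interp

/-! ## §2 Grid bridge, structured form: the off-site two-leg kernel controls the reading minus a θ-free constant -/

section Grid

variable {L M : ℕ} [NeZero L] [NeZero M] {P : Type*} [Fintype P] [DecidableEq P]

/-- **STRUCTURED VALUE OF THE K-SEPARATED SYMBOL FROM A GRID ELEMENT** (any frame `K`, any scale `n`): if `𝒱⁽ⁿ⁾ − 𝒩_K = map S W` for a grid element
`W` (`S = gridSubMatrix β x τ`) whose two-leg kernels have OFF-SITE pinned sums `≤ B` (`Σ_{p₁} [x⃗ p₁ ≠ x⃗ p₀]·‖kernel W 2 (…)‖ ≤ B`, both spins, every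
`p₀`), then `|I_L[σ_n − K∘p](q) − τ| ≤ (2|P|/(|β|L²))·B` at every continuum momentum, `τ := (σ_n − K∘p)_c(0)` (θ-free).  The on-site part of the kernel —
in particular every first-order (Hartree) contribution of the on-site interaction — is absorbed in `τ` EXACTLY. -/
theorem twoLeg_sep_structuredValue_of_grid {β : ℝ} (hβ : β ≠ 0) (U μ : ℝ) (K : TrigPolyC4v) (n : ℕ) (x : P → TorusSite 2 L)
    (τ : P → ℝ) (W : GrassmannAlgebra ℂ (GridLeg P))
    (hW : klEffectiveAction L M β U μ K klE0 n - counterQuadratic L M β K =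
      ExteriorAlgebra.map (Matrix.toLin' (gridSubMatrix L M β x τ)) W)
    {B : ℝ}
    (hBoff : ∀ (σ : Fin 2) (p₀ : P), ∑ p₁ : P,
      (if x p₁ - x p₀ = 0 then (0 : ℝ) else 1) * ‖kernel ℂ W 2 (fun i => ((![p₀, p₁] i, σ), i))‖ ≤ B) :
    ∀ q : Momentum, |evalM (symInterp L (fun p => klLocSelfEnergyRe L M β U μ K n p - K.eval (latticeMomentum L p))) q -
        torusCosCoeff L (fun p => klLocSelfEnergyRe L M β U μ K n p - K.eval (latticeMomentum L p)) 0| ≤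
      2 * (Fintype.card P : ℝ) / (|β| * (L : ℝ) ^ 2) * B := by
  intro q
  have hfun : (fun p => klLocSelfEnergyRe L M β U μ K n p - K.eval (latticeMomentum L p)) =
      fun p => (∑ σ : Fin 2, ((selfEnergy L M β (ExteriorAlgebra.map (Matrix.toLin' (gridSubMatrix L M β x τ)) W) (omega0 M, p) σ).re +
        (selfEnergy L M β (ExteriorAlgebra.map (Matrix.toLin' (gridSubMatrix L M β x τ)) W) ((omega0 M).rev, p) σ).re)) / 4 := by
    funext p
    rw [klLocSelfEnergyRe_sub_frame_eq_locRe hβ U μ K n p, hW]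
  rw [hfun]
  refine (abs_evalM_symInterp_sub_torusCosCoeff_zero_le L _ q).trans ?_
  rw [sum_filter_ne_zero_abs_torusCosCoeff_eq]
  exact sum_evenWeight_abs_torusCosCoeff_locRe_map_gridSub_le (L := L) (M := M) hβ x τ W (w := fun z => if z = 0 then (0 : ℝ) else 1)
    (fun z => by split_ifs <;> norm_num) (fun z => by simp only [neg_eq_zero]) hBoff

/-! ## §3 The bare frame `K₀ = 0`, scale `0`: representation discharged -/

/-- **THE SCALE-0, BARE-FRAME STRUCTURED VALUE FROM THE GRID.**  With `W₀ := effAction (S_{4M}ᵀ C⁰_{>e₀} S_{4M}) V_{4M}` (no counterterm anywhere): if the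
OFF-SITE pinned sums of its two-leg kernel are `≤ B` (both spins, every grid point `p₀`), then at every continuum momentum
`|I_L[σ₀](q) − τ₀| ≤ (2·|GridPoint L 4M|/(|β|L²))·B`, `τ₀ := (σ₀)_c(0) = L⁻²Σ_k σ₀(k)` (the momentum mean of the scale-`0` symbol; θ-free). -/
theorem twoLeg_structuredValue_zero_frameZero_of_grid {β : ℝ} (hβ : β ≠ 0) (U μ : ℝ) {B : ℝ}
    (hBoff : ∀ (σ : Fin 2) (p₀ : GridPoint L (2 * (2 * M))), ∑ p₁ : GridPoint L (2 * (2 * M)),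
      (if p₁.2 - p₀.2 = 0 then (0 : ℝ) else 1) *
        ‖kernel ℂ
          (effAction ℂ ((hubbardGridSub L M β (2 * (2 * M))).transpose * hubbardCovAboveCT L M β μ 0 0 klE0 *
              hubbardGridSub L M β (2 * (2 * M))) (hubbardGridInteraction L (2 * (2 * M)) β U))
          2 (fun i => ((![p₀, p₁] i, σ), i))‖ ≤ B) :
    ∀ q : Momentum, |evalM (symInterp L (klLocSelfEnergyRe L M β U μ 0 0)) q - torusCosCoeff L (klLocSelfEnergyRe L M β U μ 0 0) 0| ≤
      2 * (Fintype.card (GridPoint L (2 * (2 * M))) : ℝ) / (|β| * (L : ℝ) ^ 2) * B := by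
  intro q
  have h := twoLeg_sep_structuredValue_of_grid (L := L) (M := M) hβ U μ 0 0 (fun p : GridPoint L (2 * (2 * M)) => p.2)
    (fun p => gridTime β (2 * (2 * M)) p.1) _ (klEffectiveAction_zero_frameZero_eq_map_gridSub hβ U μ) hBoff q
  simpa only [TrigPolyC4v.eval_zero, sub_zero] using h

/-- **The reading on the free Fermi curve**: under the same off-site bound, `|ν₀(0)(θ) − τ₀| ≤ (2·|GridPoint L 4M|/(|β|L²))·B` at every angle
(`ν₀(0)(θ) = I_L[σ₀](k_F^0 θ)`). -/
theorem abs_klLocalPart_frameZero_sub_const_le_of_grid {β : ℝ} (hβ : β ≠ 0) (U μ : ℝ) {B : ℝ}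
    (hBoff : ∀ (σ : Fin 2) (p₀ : GridPoint L (2 * (2 * M))), ∑ p₁ : GridPoint L (2 * (2 * M)),
      (if p₁.2 - p₀.2 = 0 then (0 : ℝ) else 1) *
        ‖kernel ℂ
          (effAction ℂ ((hubbardGridSub L M β (2 * (2 * M))).transpose * hubbardCovAboveCT L M β μ 0 0 klE0 *
              hubbardGridSub L M β (2 * (2 * M))) (hubbardGridInteraction L (2 * (2 * M)) β U))
          2 (fun i => ((![p₀, p₁] i, σ), i))‖ ≤ B) (θ : ℝ) :
    |klLocalPart L M β U μ 0 0 θ - torusCosCoeff L (klLocSelfEnergyRe L M β U μ 0 0) 0| ≤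
      2 * (Fintype.card (GridPoint L (2 * (2 * M))) : ℝ) / (|β| * (L : ℝ) ^ 2) * B := by
  have h := twoLeg_structuredValue_zero_frameZero_of_grid (L := L) (M := M) hβ U μ hBoff (WithLp.toLp 2 (klFermiPoint μ 0 θ))
  simpa only [evalM_apply, klLocalPart] using h

/-! ## §4 Consumer doors: the natural normalisation `B = b·U²·β/(4M)` -/

/-- `(2·|GridPoint L 4M|/(|β|L²))·(b·U²·(β/4M)) = 2b·U²` (`|GridPoint L N| = N·L²`, `β > 0`). -/
theorem gridNorm_mul_natural {β : ℝ} (hβ : 0 < β) (b U : ℝ) :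
    2 * (Fintype.card (GridPoint L (2 * (2 * M))) : ℝ) / (|β| * (L : ℝ) ^ 2) * (b * U ^ 2 * (β / ((2 * (2 * M) : ℕ) : ℝ))) =
      2 * b * U ^ 2 := by
  have h := gridNorm_mul_eq (L := L) (M := M) hβ (b * U ^ 2)
  rw [h]; ring

/-- **THE DOOR FOR A NATURAL-SIZE SUPPLIER** («(C)-SCALE0-NATURAL»): an off-site pinned bound `b·U²·β/(4M)` on the two-leg kernel of `W₀` gives the
structured value `|ν₀(0)(θ) − τ₀| ≤ 2b·U²` — the `hAval` input of `twoLegReadPriv_zero` with `a := 2b` (via `klLocalPart_zero_frame_eq_profile`). -/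
theorem abs_klTwoLegCurveProfile_frameZero_sub_const_le_of_offSite {β : ℝ} (hβ : 0 < β) (U μ : ℝ) {b : ℝ}
    (hBoff : ∀ (σ : Fin 2) (p₀ : GridPoint L (2 * (2 * M))), ∑ p₁ : GridPoint L (2 * (2 * M)),
      (if p₁.2 - p₀.2 = 0 then (0 : ℝ) else 1) *
        ‖kernel ℂ
          (effAction ℂ ((hubbardGridSub L M β (2 * (2 * M))).transpose * hubbardCovAboveCT L M β μ 0 0 klE0 *
              hubbardGridSub L M β (2 * (2 * M))) (hubbardGridInteraction L (2 * (2 * M)) β U))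
          2 (fun i => ((![p₀, p₁] i, σ), i))‖ ≤ b * U ^ 2 * (β / ((2 * (2 * M) : ℕ) : ℝ))) (θ : ℝ) :
    |klTwoLegCurveProfile L M β U μ 0 0 θ - torusCosCoeff L (klLocSelfEnergyRe L M β U μ 0 0) 0| ≤ 2 * b * U ^ 2 := by
  rw [← C4a.klLocalPart_zero_frame_eq_profile β U μ θ, ← gridNorm_mul_natural (L := L) (M := M) hβ b U]
  exact abs_klLocalPart_frameZero_sub_const_le_of_grid hβ.ne' U μ hBoff θ

/-- **The mean-free clause at scale `0` from a natural-size off-site bound**: `TwoLegReadOscAt L M (4b) β U μ (klFlowFrameU … 0) 0` (continuity of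
`ν₀(0)` from the jets conjunct, e.g. `hJ.1.continuous`). -/
theorem twoLegReadOscAt_frameZero_of_offSite {β : ℝ} (hβ : 0 < β) (U μ : ℝ) {b : ℝ}
    (hcont : Continuous fun θ : ℝ => klLocalPart L M β U μ 0 0 θ)
    (hBoff : ∀ (σ : Fin 2) (p₀ : GridPoint L (2 * (2 * M))), ∑ p₁ : GridPoint L (2 * (2 * M)),
      (if p₁.2 - p₀.2 = 0 then (0 : ℝ) else 1) *
        ‖kernel ℂ
          (effAction ℂ ((hubbardGridSub L M β (2 * (2 * M))).transpose * hubbardCovAboveCT L M β μ 0 0 klE0 *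
              hubbardGridSub L M β (2 * (2 * M))) (hubbardGridInteraction L (2 * (2 * M)) β U))
          2 (fun i => ((![p₀, p₁] i, σ), i))‖ ≤ b * U ^ 2 * (β / ((2 * (2 * M) : ℕ) : ℝ))) :
    TwoLegReadOscAt L M (4 * b) β U μ (klFlowFrameU L M β U μ 0) 0 :=
  twoLegReadOscAt_zero_of_structured hcont (abs_klTwoLegCurveProfile_frameZero_sub_const_le_of_offSite hβ U μ hBoff) (by linarith)

end Grid

/-! ## §5 The tree's generous instance: p1b's determinant bound at `k = 0` -/

section Model

variable {L M : ℕ} [NeZero L] [NeZero M] {R : RenConsts} {μ U β : ℝ}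

/-- **The off-site pinned sum of `W₀`'s two-leg kernel at the tree's constants** (p1b's `twoLeg_offDiag_moment_pow_sum_frameZero_le` at `k = 0` with the
UNWEIGHTED covariance size `a₀ = klScaleZeroA0` of `rowSum/colSum_scaleZero_le_A0`): `≤ 2⁹·e¹⁸·κ₀⁴·klScaleZeroA0·U²·β/(4M)` under
`16e⁹κ₀²·klScaleZeroA0·|U| ≤ 1/4`. -/
theorem twoLeg_offSite_sum_frameZero_le (hR : R.WF) (Nsc : ℕ) (hμ : μ ∈ klWindowC) (hU : 0 < U) (hβ : klBetaMin ≤ β)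
    (hL : klEngL₃ β U ≤ L) (hM : klEngM₃ β U L ≤ M)
    (hsmall₀ : 16 * Real.exp 1 ^ 9 * Real.sqrt (2 * (7 + 1606732)) ^ 2 * klScaleZeroA0 * |U| ≤ 1 / 4)
    (σ : Fin 2) (p₀ : GridPoint L (2 * (2 * M))) :
    ∑ p₁ : GridPoint L (2 * (2 * M)), (if p₁.2 - p₀.2 = 0 then (0 : ℝ) else 1) *
      ‖kernel ℂ (effAction ℂ ((hubbardGridSub L M β (2 * (2 * M))).transpose * hubbardCovAboveCT L M β μ 0 0 klE0 *
            hubbardGridSub L M β (2 * (2 * M))) (hubbardGridInteraction L (2 * (2 * M)) β U))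
        2 (fun i => ((![p₀, p₁] i, σ), i))‖ ≤
      (2 : ℝ) ^ 9 * Real.exp 1 ^ 18 * Real.sqrt (2 * (7 + 1606732)) ^ 4 * klScaleZeroA0 * U ^ 2 * (β / ((2 * (2 * M) : ℕ) : ℝ)) := by
  obtain ⟨-, -, -, -, hβ3M, -⟩ := scaleZero_regime_sizes (U := U) hβ hL hM
  have hK0 : FrameOK R U Nsc μ 0 := klFrameOK_zeroC hR U Nsc hμ
  have hwt : ∀ S : Finset (ZMod (2 * (2 * M)) × TorusSite 2 L),
      diamWeight (fun s => (1 + 1 * s) ^ 0) (gridLabelDist L (2 * (2 * M)) β) S = 1 := fun S => by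
    simp [diamWeight]
  have hrow : ∀ X, ∑ Y, ‖((hubbardGridSub L M β (2 * (2 * M))).transpose * hubbardCovAboveCT L M β μ 0 0 klE0 *
        hubbardGridSub L M β (2 * (2 * M))) X Y‖ *
        diamWeight (fun s => (1 + 1 * s) ^ 0) (gridLabelDist L (2 * (2 * M)) β) {gridLegPos X, gridLegPos Y} ≤
          klScaleZeroA0 * ((2 * (2 * M) : ℕ) : ℝ) / β := fun X => by
    simp_rw [hwt, mul_one]
    exact (rowSum_scaleZero_le_A0 (L := L) hK0 hβ hβ3M X).trans (le_of_eq (by ring))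
  have hcol : ∀ Y, ∑ X, ‖((hubbardGridSub L M β (2 * (2 * M))).transpose * hubbardCovAboveCT L M β μ 0 0 klE0 *
        hubbardGridSub L M β (2 * (2 * M))) X Y‖ *
        diamWeight (fun s => (1 + 1 * s) ^ 0) (gridLabelDist L (2 * (2 * M)) β) {gridLegPos X, gridLegPos Y} ≤
          klScaleZeroA0 * ((2 * (2 * M) : ℕ) : ℝ) / β := fun Y => by
    simp_rw [hwt, mul_one]
    exact (colSum_scaleZero_le_A0 (L := L) hK0 hβ hβ3M Y).trans (le_of_eq (by ring))
  have hsmall : 16 * Real.exp 1 ^ 9 * Real.sqrt (2 * (7 + 1606732)) ^ 2 * klScaleZeroA0 * |U| ≤ 1 / 2 :=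
    hsmall₀.trans (by norm_num)
  have h := twoLeg_offDiag_moment_pow_sum_frameZero_le (L := L) (M := M) hR Nsc hμ hU hβ hL hM 0 klScaleZeroA0_pos hrow hcol hsmall σ p₀
  refine le_trans (le_of_eq (sum_congr rfl fun p₁ _ => ?_)) (h.trans (le_of_eq (by ring)))
  by_cases hp : p₁.2 - p₀.2 = 0
  · rw [if_pos hp, if_pos hp]
  · rw [if_neg hp, if_neg hp, pow_zero]

/-- **THE GENEROUS STRUCTURED VALUE AT THE BARE FRAME**: under the regime binders and `16e⁹κ₀²·klScaleZeroA0·|U| ≤ 1/4`,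
`|ν₀(0)(θ) − τ₀| ≤ 2¹⁰·e¹⁸·κ₀⁴·klScaleZeroA0·U²` at every angle (`τ₀ = L⁻²Σ_k σ₀(k)`).  [≈ 1.9·10³⁷·U²/2 — records the size of the tree's only scale-`0`
supplier; the private first step of (C) needs `≲ 0.2·U²`.] -/
theorem abs_klLocalPart_frameZero_sub_const_le_generous (hR : R.WF) (Nsc : ℕ) (hμ : μ ∈ klWindowC) (hU : 0 < U) (hβ : klBetaMin ≤ β)
    (hL : klEngL₃ β U ≤ L) (hM : klEngM₃ β U L ≤ M)
    (hsmall₀ : 16 * Real.exp 1 ^ 9 * Real.sqrt (2 * (7 + 1606732)) ^ 2 * klScaleZeroA0 * |U| ≤ 1 / 4) (θ : ℝ) :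
    |klLocalPart L M β U μ 0 0 θ - torusCosCoeff L (klLocSelfEnergyRe L M β U μ 0 0) 0| ≤
      (2 : ℝ) ^ 10 * Real.exp 1 ^ 18 * Real.sqrt (2 * (7 + 1606732)) ^ 4 * klScaleZeroA0 * U ^ 2 := by
  have hβ0 : 0 < β := lt_of_lt_of_le (by norm_num [klBetaMin]) hβ
  have h := abs_klLocalPart_frameZero_sub_const_le_of_grid (L := L) (M := M) hβ0.ne' U μ
    (fun σ p₀ => twoLeg_offSite_sum_frameZero_le hR Nsc hμ hU hβ hL hM hsmall₀ σ p₀) θ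
  refine h.trans (le_of_eq ?_)
  rw [show (2 : ℝ) ^ 9 * Real.exp 1 ^ 18 * Real.sqrt (2 * (7 + 1606732)) ^ 4 * klScaleZeroA0 * U ^ 2 * (β / ((2 * (2 * M) : ℕ) : ℝ)) =
      ((2 : ℝ) ^ 9 * Real.exp 1 ^ 18 * Real.sqrt (2 * (7 + 1606732)) ^ 4 * klScaleZeroA0) * U ^ 2 * (β / ((2 * (2 * M) : ℕ) : ℝ)) by ring,
    gridNorm_mul_natural (L := L) (M := M) hβ0]
  ring

/-- **The generous mean-free clause at scale `0`**: `TwoLegReadOscAt L M (2¹¹·e¹⁸·κ₀⁴·klScaleZeroA0) β U μ (klFlowFrameU … 0) 0` under the same binders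
(continuity of `ν₀(0)` supplied, e.g. from the jets conjunct). -/
theorem twoLegReadOscAt_frameZero_generous (hR : R.WF) (Nsc : ℕ) (hμ : μ ∈ klWindowC) (hU : 0 < U) (hβ : klBetaMin ≤ β)
    (hL : klEngL₃ β U ≤ L) (hM : klEngM₃ β U L ≤ M)
    (hsmall₀ : 16 * Real.exp 1 ^ 9 * Real.sqrt (2 * (7 + 1606732)) ^ 2 * klScaleZeroA0 * |U| ≤ 1 / 4)
    (hcont : Continuous fun θ : ℝ => klLocalPart L M β U μ 0 0 θ) :
    TwoLegReadOscAt L M ((2 : ℝ) ^ 11 * Real.exp 1 ^ 18 * Real.sqrt (2 * (7 + 1606732)) ^ 4 * klScaleZeroA0) β U μ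
      (klFlowFrameU L M β U μ 0) 0 := by
  refine twoLegReadOscAt_zero_of_structured (τ := torusCosCoeff L (klLocSelfEnergyRe L M β U μ 0 0) 0)
    (a := (2 : ℝ) ^ 10 * Real.exp 1 ^ 18 * Real.sqrt (2 * (7 + 1606732)) ^ 4 * klScaleZeroA0) hcont (fun θ => ?_) (le_of_eq (by ring))
  rw [← C4a.klLocalPart_zero_frame_eq_profile β U μ θ]
  exact abs_klLocalPart_frameZero_sub_const_le_generous hR Nsc hμ hU hβ hL hM hsmall₀ θ

/-- **The same under stub (C)'s `U`-binder** `U ≤ klEngU₀9 P R c` (`0 < R.cz`): the smallness is `bareFrame_numerals_of_le_klEngU₀9`'s first numeral. -/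
theorem abs_klLocalPart_frameZero_sub_const_le_klEng (P : SplitConsts) (hR : R.WF) (hcz : 0 < R.cz) {c : ℝ} (hμ : μ ∈ klWindowC)
    (hU : 0 < U) (hU9 : U ≤ klEngU₀9 P R c) (hβ : klBetaMin ≤ β) (hL : klEngL₃ β U ≤ L) (hM : klEngM₃ β U L ≤ M) (θ : ℝ) :
    |klLocalPart L M β U μ 0 0 θ - torusCosCoeff L (klLocSelfEnergyRe L M β U μ 0 0) 0| ≤
      (2 : ℝ) ^ 10 * Real.exp 1 ^ 18 * Real.sqrt (2 * (7 + 1606732)) ^ 4 * klScaleZeroA0 * U ^ 2 :=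
  abs_klLocalPart_frameZero_sub_const_le_generous hR 0 hμ hU hβ hL hM (bareFrame_numerals_of_le_klEngU₀9 P hcz hU hU9).1 θ

end Model

end Summit.HubbardSuperconductivity.HubbardSuperconductivity.Theorems.KLRegimeSplit

end
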